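import Mathlib.MeasureTheory.Measure.Prod
import HarnessLib

/-!
# `FluctuationComparisonRegPrIntLS1aSliceNullOfBiEquivariant` — A MEASURABLE SET OF A PRODUCT WHOSE VERTICAL SLICES ARE ALL NULL AND WHICH IS
# STABLE UNDER A FAMILY OF PRODUCT MAPS, MEASURE-PRESERVING IN THE FIRST FACTOR AND JOINTLY TRANSITIVE ON THE SECOND, HAS EVERY HORIZONTAL SLICE NULL
# («endpoint-gauge transitivity»: the per-datum null sets of S1aᴴ's window-continuity conjunct (c) at the anchor heights, EML branch)

Cell `ym3-torus` (HUMAN RULING D-0037: rung R3 = continuum SU(2) Yang–Mills on T³ — NOT d = 4, NOT infinite volume, NOT a mass gap, NOT Clay), WIDTH COPY «width 17»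
of ym3-torus-p1, seat `ym3-torus-px17` gen 21; `--kind proof --supports stmt-QuantumFields-20520 --as helper` (count-neutral).  THEOREMS ONLY (no `def`, no `sorry`,
no `instance`, no `notation`, default heartbeats); Mathlib-only imports.  FILE (F1) of the seat's 12:58Z INTENT (S1aᴴ `RunClassMembershipH` conjunct (c)
`ContinuousOn (ρ j) {PlaqSmall θ_j}` at the ANCHOR heights `Ts ≤ j < K`, local-face road on the full guard; UV3-NODE §77.9 «NOT settled (b)»).

WHY.  Reading one UNCUT (0.4) step `T = (avgFun ℰp)_*` of [Balaban1987RG1] for CONTINUITY of densities by dominated convergence over the non-private bond variables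
`x` (lit ✓`BlockAveragingHaarAC` ∕ ✓`BlockAveragingEMLHaarAC` §1: private coordinates, W-coordinate guard `fibreGuard`, fibre map `fibreMap`) needs, FOR EVERY coarse bond
value `v` (not merely for almost every `v`), that the environments `x` for which `v` lies on the image `E_c(x, ∂G_c(x))` of the guard frontier under the exp-mean-log branch
form a null set.  For each FIXED `x` that image is Haar-null (a `C¹` image of finitely many `dist1`-spheres), and the set `S = {(x, v) | v ∈ E_c(x, ∂G_c(x))}` is stable
under every fine gauge transformation `g` — Haar-preserving on `x`, acting on the coarse bond value by `v ↦ g(x_c)·v·g(x_c′)⁻¹` (the two DISTINCT fine endpoints of `c`) —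
and that action of `SU(2) × SU(2)` on `SU(2)` is TRANSITIVE.  THIS FILE is the abstract measure-theoretic step that turns «every vertical slice null» into «every
horizontal slice null» under such a symmetry, with no transversality, no fold analysis and no smallness: the function `v ↦ μ {x | (x, v) ∈ S}` is constant along the
action (measure preservation + stability), hence constant (transitivity), and its integral is `(μ ⊗ ν)(S) = ∫ ν(S_x) dμ = 0` (Tonelli both ways).

CONTENT (namespace `Summit.QuantumFields.YangMills.Theorems.FluctuationComparisonRegPrIntLS1aSliceNullOfBiEquivariant`; `μ`, `ν` s-finite).
* §1 slices: `measurableSet_hSlice` ∕ `measurableSet_vSlice`; `prod_eq_lintegral_vSlice` ∕ `prod_eq_lintegral_hSlice` (Tonelli, Mathlib `Measure.prod_apply` ∕ `prod_apply_symm`);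
  ★`prod_eq_zero_of_ae_vSlice_null` (a.e. null vertical slices ⇒ product-null); ★`ae_hSlice_null_of_prod_eq_zero` (product-null ⇒ a.e. horizontal slice null).
* §2 ★★`hSlice_le_of_stable` (ONE stabilising pair `(φ, ψ)`, `φ` measure-preserving: `μ S^{v} ≤ μ S^{ψ v}`), ★★`hSlice_eq_of_biStable`.
* §3 ★★★`hSlice_null_of_transitive` — THE LEMMA: `S` measurable, `ν`-a.e. (in particular every) vertical slice `ν`-null, a family `(φ i, ψ i)` with each `φ i` measure-preserving
  for `μ` and `(x, v) ∈ S → (φ i x, ψ i v) ∈ S`, JOINTLY TRANSITIVE on the second factor (`∀ v w, ∃ i, ψ i v = w`), `ν ≠ 0` ⟹ `μ {x | (x, v) ∈ S} = 0` for EVERY `v`;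
  ★★`hSlice_null_of_transitive'` (the same from everywhere-null vertical slices); ★`measure_setOf_mem_hSlice_eq_zero_of_transitive` (`Set`-builder spelling for consumers).

AS PRINTED vs AS TYPED (★p1 «every gap named»).  Print never needs continuity of the renormalised densities `ρ_k` ([Balaban1985UV3] integrates (41)∕(47) against characteristic
functions); the tree's S1aᴴ (c) does, at uncut heights too (`Lines/runpair_organ.lean` :564–:579, `Ts` arbitrary).  This lemma is the symmetry that makes the uncut (large-field)
jump locus of the guarded average (cell row T4-D.L, `BlockAveraging.corr`) invisible datum-by-datum; it is [folklore] measure theory (Tonelli + invariance), no Bałaban content.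

HONEST FRAMING.  Generic measure theory over Mathlib; nothing of Bałaban's analysis is asserted or proved; S1aᴴ's (c) at the anchor heights is NOT closed by this file (files
(F2)–(F6) of the INTENT remain); (m), (a), S1aᴴ, 26243, S2β, the five registered stubs of `Lines/semiclassical_s2beta.lean`, crux 20520 ∕ 19936 ∕ 19200 and `YM3TorusSU2`
are NOT proved; no registered stub is closed; registry untouched; rung R3 = SU(2) YM₃ on T³ at fixed lattice data — NOT d = 4, NOT infinite volume, NOT a mass gap, NOT Clay;
the Yang–Mills mass gap is NOT proved by any of this.
References: [Balaban1987RG1] CMP 109 (1987) (0.4) p. 253; [Balaban1985UV3] CMP 102 (1985) p. 263 (c).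
-/

set_option autoImplicit false

noncomputable section

namespace Summit.QuantumFields.YangMills.Theorems.FluctuationComparisonRegPrIntLS1aSliceNullOfBiEquivariant

open MeasureTheory Set Function
open scoped ENNReal

variable {X V : Type*} [MeasurableSpace X] [MeasurableSpace V]

/-! ## §1 Slices of a measurable set of a product; Tonelli both ways -/

section Slices

/-- The HORIZONTAL slice `{x | (x, v) ∈ S}` of a measurable set of `X × V` at `v` is measurable. [folklore] -/
theorem measurableSet_hSlice {S : Set (X × V)} (hS : MeasurableSet S) (v : V) : MeasurableSet {x | (x, v) ∈ S} :=
  measurable_prodMk_right hS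

/-- The VERTICAL slice `{v | (x, v) ∈ S}` of a measurable set of `X × V` at `x` is measurable. [folklore] -/
theorem measurableSet_vSlice {S : Set (X × V)} (hS : MeasurableSet S) (x : X) : MeasurableSet {v | (x, v) ∈ S} :=
  measurable_prodMk_left hS

variable (μ : Measure X) (ν : Measure V) [SFinite μ] [SFinite ν]

omit [SFinite μ] in
/-- TONELLI, vertical slices: `(μ ⊗ ν)(S) = ∫⁻ x, ν {v | (x, v) ∈ S} dμ`. [folklore] -/
theorem prod_eq_lintegral_vSlice {S : Set (X × V)} (hS : MeasurableSet S) :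
    μ.prod ν S = ∫⁻ x, ν {v | (x, v) ∈ S} ∂μ :=
  Measure.prod_apply hS

/-- TONELLI, horizontal slices: `(μ ⊗ ν)(S) = ∫⁻ v, μ {x | (x, v) ∈ S} dν`. [folklore] -/
theorem prod_eq_lintegral_hSlice {S : Set (X × V)} (hS : MeasurableSet S) :
    μ.prod ν S = ∫⁻ v, μ {x | (x, v) ∈ S} ∂ν :=
  Measure.prod_apply_symm hS

omit [SFinite μ] in
/-- ★ A measurable set almost all of whose VERTICAL slices are `ν`-null is `(μ ⊗ ν)`-null. [folklore] -/
theorem prod_eq_zero_of_ae_vSlice_null {S : Set (X × V)} (hS : MeasurableSet S) (h : ∀ᵐ x ∂μ, ν {v | (x, v) ∈ S} = 0) :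
    μ.prod ν S = 0 := by
  rw [prod_eq_lintegral_vSlice μ ν hS, lintegral_congr_ae h, lintegral_zero]

/-- ★ A `(μ ⊗ ν)`-null measurable set has `μ`-null HORIZONTAL slices at `ν`-almost every `v`. [folklore] -/
theorem ae_hSlice_null_of_prod_eq_zero {S : Set (X × V)} (hS : MeasurableSet S) (h : μ.prod ν S = 0) :
    ∀ᵐ v ∂ν, μ {x | (x, v) ∈ S} = 0 := by
  have hm : Measurable fun v => μ {x | (x, v) ∈ S} := measurable_measure_prodMk_right hS
  rw [prod_eq_lintegral_hSlice μ ν hS] at h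
  exact (lintegral_eq_zero_iff hm).1 h

end Slices

/-! ## §2 Stability under a product map that preserves `μ` on the first factor -/

section Stable

variable (μ : Measure X)

/-- ★★ ONE STABILISING PAIR: if `φ : X → X` preserves `μ` and `(x, v) ∈ S → (φ x, ψ v) ∈ S`, then the horizontal slice at `v` is no larger than the one at `ψ v`:
`μ {x | (x, v) ∈ S} ≤ μ {x | (x, ψ v) ∈ S}` (the slice at `v` lies in the `φ`-preimage of the slice at `ψ v`). [folklore] -/
theorem hSlice_le_of_stable {S : Set (X × V)} (hS : MeasurableSet S) {φ : X → X} {ψ : V → V} (hφ : MeasurePreserving φ μ μ)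
    (hst : ∀ x v, (x, v) ∈ S → (φ x, ψ v) ∈ S) (v : V) :
    μ {x | (x, v) ∈ S} ≤ μ {x | (x, ψ v) ∈ S} := by
  have hsub : {x | (x, v) ∈ S} ⊆ φ ⁻¹' {x | (x, ψ v) ∈ S} := fun x hx => hst x v hx
  calc μ {x | (x, v) ∈ S} ≤ μ (φ ⁻¹' {x | (x, ψ v) ∈ S}) := measure_mono hsub
    _ = μ {x | (x, ψ v) ∈ S} := hφ.measure_preimage (measurableSet_hSlice hS (ψ v)).nullMeasurableSet

/-- ★★ A FAMILY of stabilising pairs, jointly transitive on `V`: all horizontal slices have the SAME measure. [folklore] -/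
theorem hSlice_eq_of_biStable {ι : Type*} {S : Set (X × V)} (hS : MeasurableSet S) {φ : ι → X → X} {ψ : ι → V → V}
    (hφ : ∀ i, MeasurePreserving (φ i) μ μ) (hst : ∀ i x v, (x, v) ∈ S → (φ i x, ψ i v) ∈ S)
    (htrans : ∀ v w : V, ∃ i, ψ i v = w) (v w : V) :
    μ {x | (x, v) ∈ S} = μ {x | (x, w) ∈ S} := by
  apply le_antisymm
  · obtain ⟨i, hi⟩ := htrans v w
    rw [← hi]
    exact hSlice_le_of_stable μ hS (hφ i) (hst i) v
  · obtain ⟨i, hi⟩ := htrans w v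
    rw [← hi]
    exact hSlice_le_of_stable μ hS (hφ i) (hst i) w

end Stable

/-! ## §3 The lemma: bi-stable with a transitive second action and null vertical slices ⇒ EVERY horizontal slice null -/

section Transitive

variable (μ : Measure X) (ν : Measure V) [SFinite μ] [SFinite ν]

/-- ★★★ **ENDPOINT-GAUGE TRANSITIVITY, abstract form.**  Let `S ⊆ X × V` be measurable with `ν`-null vertical slice `{v | (x, v) ∈ S}` for `μ`-almost every `x`; let a family
of pairs `(φ i, ψ i)` stabilise `S` (`(x, v) ∈ S → (φ i x, ψ i v) ∈ S`) with every `φ i` measure-preserving for `μ` and the `ψ i` jointly TRANSITIVE on `V`; let `ν ≠ 0`.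
Then the horizontal slice `{x | (x, v) ∈ S}` is `μ`-null for EVERY `v : V` — not merely for `ν`-almost every `v`.  (All horizontal slices have one common measure `m` by §2;
Tonelli both ways gives `m · ν univ = (μ ⊗ ν)(S) = 0`.) [folklore] -/
theorem hSlice_null_of_transitive {ι : Type*} {S : Set (X × V)} (hS : MeasurableSet S) (hv : ∀ᵐ x ∂μ, ν {v | (x, v) ∈ S} = 0)
    {φ : ι → X → X} {ψ : ι → V → V} (hφ : ∀ i, MeasurePreserving (φ i) μ μ) (hst : ∀ i x v, (x, v) ∈ S → (φ i x, ψ i v) ∈ S)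
    (htrans : ∀ v w : V, ∃ i, ψ i v = w) (hν : ν ≠ 0) (v : V) :
    μ {x | (x, v) ∈ S} = 0 := by
  have hprod : μ.prod ν S = 0 := prod_eq_zero_of_ae_vSlice_null μ ν hS hv
  have hconst : ∀ w, μ {x | (x, w) ∈ S} = μ {x | (x, v) ∈ S} := fun w => hSlice_eq_of_biStable μ hS hφ hst htrans w v
  have hint : ∫⁻ w, μ {x | (x, w) ∈ S} ∂ν = μ {x | (x, v) ∈ S} * ν univ := by
    rw [lintegral_congr (fun w => hconst w), lintegral_const]
  have h0 : μ {x | (x, v) ∈ S} * ν univ = 0 := by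
    rw [← hint, ← prod_eq_lintegral_hSlice μ ν hS, hprod]
  rcases mul_eq_zero.1 h0 with h | h
  · exact h
  · exact absurd (Measure.measure_univ_eq_zero.1 h) hν

/-- ★★ The same with EVERYWHERE-null vertical slices (the form the consumer has: for each fixed environment the image of the guard frontier is Haar-null). [folklore] -/
theorem hSlice_null_of_transitive' {ι : Type*} {S : Set (X × V)} (hS : MeasurableSet S) (hv : ∀ x, ν {v | (x, v) ∈ S} = 0)
    {φ : ι → X → X} {ψ : ι → V → V} (hφ : ∀ i, MeasurePreserving (φ i) μ μ) (hst : ∀ i x v, (x, v) ∈ S → (φ i x, ψ i v) ∈ S)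
    (htrans : ∀ v w : V, ∃ i, ψ i v = w) (hν : ν ≠ 0) (v : V) :
    μ {x | (x, v) ∈ S} = 0 :=
  hSlice_null_of_transitive μ ν hS (ae_of_all μ hv) hφ hst htrans hν v

/-- ★ CONSUMER SPELLING: for a binary predicate `R` with measurable graph `{p | R p.1 p.2}`, everywhere-null `{v | R x v}`, stabilising measure-preserving∕transitive pairs and
`ν ≠ 0`, the set `{x | R x v}` is `μ`-null for every `v`. [folklore] -/
theorem measure_setOf_eq_zero_of_transitive {ι : Type*} {R : X → V → Prop} (hR : MeasurableSet {p : X × V | R p.1 p.2})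
    (hv : ∀ x, ν {v | R x v} = 0) {φ : ι → X → X} {ψ : ι → V → V} (hφ : ∀ i, MeasurePreserving (φ i) μ μ)
    (hst : ∀ i x v, R x v → R (φ i x) (ψ i v)) (htrans : ∀ v w : V, ∃ i, ψ i v = w) (hν : ν ≠ 0) (v : V) :
    μ {x | R x v} = 0 :=
  hSlice_null_of_transitive' μ ν (S := {p : X × V | R p.1 p.2}) hR hv hφ (fun i x v h => hst i x v h) htrans hν v

end Transitive

end Summit.QuantumFields.YangMills.Theorems.FluctuationComparisonRegPrIntLS1aSliceNullOfBiEquivariant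

end
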